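import Literature.Analysis.Pluripotential.RegularisedMax
import Literature.Geometry.Symplectic.LegendrianStabilisationModel
import Literature.Topology.FourManifolds.PlanarArch
import HarnessLib

/-!
# One-variable profiles for the ladder Morse function: smooth sign, bump, barrier

Topic `Literature/Topology/FourManifolds`; brick E0-q (part 1) of the constructive road (P1′) to
`Literature.Topology.FourManifolds.Trisection.isConnectedSum_of_reducing_separating`
(`ReducibleTrisectionSplitting.lean`, § Status).  The `4`-dimensional `1`-handlebody model used
there is a thickened planar domain `{q(x, y) + z² + w² ≤ c}`
(`Literature.Topology.FourManifolds.IsHoledDiscMorseFunction.FourThickening`,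
`ThickenedHandlebodyFour.lean`) for an EXPLICIT planar Morse function `q` — the *ladder* of the
sequel file — whose sublevel set has straight product *bridges* `q = τ x + (|y| - 1)²`.  The
ladder is assembled from three one-variable profiles, studied here by elementary calculus:

* §1 complements on the smooth sign `σ = smoothSign` of `RegularisedMax.lean`
  (`σ(0) = 0`, `σ' > 0` on `(-1, 1)`, `σ > 0` on `(0, ∞)`, `|σ| < 1` exactly on `(-1, 1)`, and a
  linear lower bound `m₀ t ≤ σ(t)` on `[0, 1]`, `exists_slope_le_smoothSign`);
* §2 the bump `b(x) = expNegInvGlue (1 - x²)` of `LegendrianStabilisationModel.lean`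
  (`Literature.Geometry.Symplectic.LegendrianModel.bump`, `= e^{-1/(1-x²)}` on `(-1, 1)`, `0`
  outside; derivative `dbump`): on `(-1, 1)`, `b' = -2x (1 - x²)⁻² b` (`dbump_eq`) and the second
  derivative is `b'' = (6x⁴ - 2)(1 - x²)⁻⁴ b` (`hasDerivAt_dbump`), whence `b'` increases strictly
  on `[-1, -x⋆]` and decreases strictly on `[-x⋆, x⋆]`, `x⋆ = 3^{-1/4}` (`strictMonoOn_dbump`,
  `strictAntiOn_dbump`), and **for `0 < θ < b'(-1/2)` the equation `b'(x) = θ` has exactly two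
  roots**, `x₁ ∈ (-1, -x⋆)` with `b''(x₁) > 0` and `x₂ ∈ (-1/2, 0)` with `b''(x₂) < 0`
  (`exists_two_roots_dbump`);
* §3 the convex barrier `p(t) = 6 ∫₀ᵗ ∫₀ˢ smoothTransition` (`barrier`): `C^∞`, `= 0` on
  `(-∞, 0]`, `p'' = 6·smoothTransition > 0` on `(0, ∞)`, `p(t) ≥ 3 (t - 1)²` for `t ≥ 1`, and for
  every `τ > 0` the equation `p'(t) = τ` has exactly one root, at which `p'' > 0`
  (`exists_unique_root_deriv_barrier`).

Everything is **proved**; definitions with bodies, no named fact.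

## References
* J. Milnor, *Lectures on the h-cobordism theorem* (1965), §8 (inserting critical points by explicit
  local formulas). [MilnorHCobordism1965]
* Standard real analysis. [folklore]
-/

noncomputable section

open scoped Topology ContDiff
open Set Filter Real MeasureTheory intervalIntegral
open Literature.Analysis.Pluripotential
open Literature.Geometry.Symplectic.LegendrianModel (bump dbump hasDerivAt_bump deriv_bump bump_pos
  bump_eq_zero bump_nonneg bump_le_bump_zero bump_lt_bump continuous_dbump dbump_eq_zero dbump_zero
  dbump_pos_of_neg dbump_neg_of_pos contDiff_bump continuous_bump dglue)

namespace Literature.Topology.FourManifolds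

namespace Ladder

/-! ### §1 Complements on the smooth sign -/

/-- `σ(0) = 0` (oddness). [folklore] -/
theorem smoothSign_zero : smoothSign 0 = 0 := by
  have h := smoothSign_neg 0
  rw [neg_zero] at h
  linarith

/-- `σ'(t) = smoothTransition' ((t + 1)/2)`. [folklore] -/
theorem hasDerivAt_smoothSign_eq (t : ℝ) :
    HasDerivAt smoothSign (deriv smoothTransition ((t + 1) / 2)) t := by
  have h1 : HasDerivAt (fun s : ℝ => (s + 1) / 2) (1 / 2 : ℝ) t := by
    simpa using ((hasDerivAt_id t).add_const 1).div_const 2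
  have h2 : HasDerivAt smoothTransition (deriv smoothTransition ((t + 1) / 2)) ((t + 1) / 2) :=
    ((smoothTransition.contDiff (n := 1)).differentiable one_ne_zero _).hasDerivAt
  have h := ((h2.comp t h1).const_mul 2).sub_const 1
  have h' : HasDerivAt smoothSign (2 * (deriv smoothTransition ((t + 1) / 2) * (1 / 2))) t :=
    h.congr_of_eventuallyEq (Eventually.of_forall fun s => rfl)
  have e : (2 * (deriv smoothTransition ((t + 1) / 2) * (1 / 2))) =
      deriv smoothTransition ((t + 1) / 2) := by ring
  rw [e] at h'
  exact h'

/-- `σ' (t) = smoothTransition' ((t + 1)/2)`. [folklore] -/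
theorem deriv_smoothSign_eq (t : ℝ) :
    deriv smoothSign t = deriv smoothTransition ((t + 1) / 2) :=
  (hasDerivAt_smoothSign_eq t).deriv

/-- `σ' > 0` on `(-1, 1)`. [folklore] -/
theorem deriv_smoothSign_pos {t : ℝ} (ht : |t| < 1) : 0 < deriv smoothSign t := by
  rw [deriv_smoothSign_eq]
  have h := abs_lt.1 ht
  exact deriv_smoothTransition_pos (by linarith) (by linarith)

/-- `σ'(0) > 0`. [folklore] -/
theorem deriv_smoothSign_zero_pos : 0 < deriv smoothSign 0 :=
  deriv_smoothSign_pos (by simp)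

/-- `σ > 0` on `(0, ∞)`. [folklore] -/
theorem smoothSign_pos {t : ℝ} (ht : 0 < t) : 0 < smoothSign t := by
  rcases le_or_gt 1 t with h | h
  · rw [smoothSign_of_one_le h]; exact one_pos
  · have hlt : smoothSign 0 < smoothSign t := by
      have hm := strictMonoOn_smoothTransition ⟨by norm_num, by norm_num⟩
        ⟨by linarith, by linarith⟩ (show ((0 : ℝ) + 1) / 2 < (t + 1) / 2 by linarith)
      show 2 * smoothTransition ((0 + 1) / 2) - 1 < 2 * smoothTransition ((t + 1) / 2) - 1
      linarith
    rwa [smoothSign_zero] at hlt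

/-- `σ < 0` on `(-∞, 0)`. [folklore] -/
theorem smoothSign_neg_of_neg {t : ℝ} (ht : t < 0) : smoothSign t < 0 := by
  have h := smoothSign_pos (neg_pos.2 ht)
  rw [smoothSign_neg] at h
  linarith

/-- `|σ| < 1` on `(-1, 1)`. [folklore] -/
theorem abs_smoothSign_lt_one {t : ℝ} (ht : |t| < 1) : |smoothSign t| < 1 := by
  have h := abs_lt.1 ht
  have h1 : 0 < smoothTransition ((t + 1) / 2) := smoothTransition.pos_of_pos (by linarith)
  have h2 : smoothTransition ((t + 1) / 2) < 1 := smoothTransition.lt_one_of_lt_one (by linarith)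
  rw [abs_lt]
  constructor
  · show -1 < 2 * smoothTransition ((t + 1) / 2) - 1
    linarith
  · show 2 * smoothTransition ((t + 1) / 2) - 1 < 1
    linarith

/-- `σ² < 1` on `(-1, 1)`. [folklore] -/
theorem smoothSign_sq_lt_one {t : ℝ} (ht : |t| < 1) : smoothSign t ^ 2 < 1 := by
  have h := abs_smoothSign_lt_one ht
  have : |smoothSign t| ^ 2 < 1 ^ 2 := by
    exact pow_lt_pow_left₀ h (abs_nonneg _) two_ne_zero
  rwa [sq_abs, one_pow] at this

/-- `σ² = 1` off `(-1, 1)`. [folklore] -/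
theorem smoothSign_sq_eq_one {t : ℝ} (ht : 1 ≤ |t|) : smoothSign t ^ 2 = 1 := by
  rcases le_abs'.1 ht with h | h
  · rw [smoothSign_of_le_neg_one h]; norm_num
  · rw [smoothSign_of_one_le h]; norm_num

/-- `σ² ≤ 1`. [folklore] -/
theorem smoothSign_sq_le_one (t : ℝ) : smoothSign t ^ 2 ≤ 1 := by
  have h := abs_smoothSign_le_one t
  have : |smoothSign t| ^ 2 ≤ 1 ^ 2 := pow_le_pow_left₀ (abs_nonneg _) h 2
  rwa [sq_abs, one_pow] at this

/-- `σ'` is continuous. [folklore] -/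
theorem continuous_deriv_smoothSign : Continuous (deriv smoothSign) :=
  (contDiff_smoothSign (n := 2)).continuous_deriv (by norm_num)

/-- **A linear lower bound for the smooth sign on `[0, 1]`**: there is `m₀ > 0`, `m₀ ≤ σ'(0)`,
with `m₀ t ≤ σ(t)` for `0 ≤ t ≤ 1` (`σ'` is continuous and positive at `0`, `σ` increasing and
positive). [folklore] -/
theorem exists_slope_le_smoothSign :
    ∃ m₀ : ℝ, 0 < m₀ ∧ m₀ ≤ deriv smoothSign 0 ∧ ∀ t ∈ Icc (0 : ℝ) 1, m₀ * t ≤ smoothSign t := by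
  set d₀ := deriv smoothSign 0 with hd₀
  have hd₀pos : 0 < d₀ := deriv_smoothSign_zero_pos
  -- continuity of σ' at 0: σ' ≥ d₀/2 on [0, t₁]
  have hcont : ContinuousAt (deriv smoothSign) 0 := continuous_deriv_smoothSign.continuousAt
  have hev : ∀ᶠ t in 𝓝 (0 : ℝ), d₀ / 2 < deriv smoothSign t :=
    hcont.eventually (lt_mem_nhds (by linarith))
  obtain ⟨ε, hε, hball⟩ := Metric.eventually_nhds_iff.1 hev
  set t₁ : ℝ := min (ε / 2) 1 with ht₁
  have ht₁pos : 0 < t₁ := lt_min (by linarith) one_pos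
  have ht₁le : t₁ ≤ 1 := min_le_right _ _
  have ht₁ε : t₁ < ε := lt_of_le_of_lt (min_le_left _ _) (by linarith)
  have hder : ∀ t ∈ Icc (0 : ℝ) t₁, d₀ / 2 < deriv smoothSign t := fun t ht =>
    hball (by rw [Real.dist_eq, sub_zero, abs_of_nonneg ht.1]; linarith [ht.2])
  -- on [0, t₁]: σ t ≥ (d₀/2) t by monotonicity of σ - (d₀/2)·id
  have hmono : MonotoneOn (fun t => smoothSign t - d₀ / 2 * t) (Icc 0 t₁) := by
    refine monotoneOn_of_deriv_nonneg (convex_Icc 0 t₁) ?_ ?_ ?_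
    · exact (continuous_smoothSign.sub (continuous_const.mul continuous_id)).continuousOn
    · intro t _
      exact ((hasDerivAt_smoothSign t).sub ((hasDerivAt_id t).const_mul _)).differentiableAt
        |>.differentiableWithinAt
    · intro t ht
      rw [interior_Icc] at ht
      have hd : HasDerivAt (fun t => smoothSign t - d₀ / 2 * t) (deriv smoothSign t - d₀ / 2 * 1) t :=
        (hasDerivAt_smoothSign t).sub ((hasDerivAt_id t).const_mul (d₀ / 2))
      rw [hd.deriv, mul_one]
      linarith [hder t ⟨ht.1.le, ht.2.le⟩]
  refine ⟨d₀ / 2 * t₁, by positivity, ?_, fun t ht => ?_⟩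
  · calc d₀ / 2 * t₁ ≤ d₀ / 2 * 1 := by gcongr
      _ ≤ d₀ := by linarith
  · rcases le_or_gt t t₁ with h | h
    · have h1 := hmono ⟨le_rfl, ht₁pos.le⟩ ⟨ht.1, h⟩ ht.1
      simp only [mul_zero, sub_zero, smoothSign_zero] at h1
      calc d₀ / 2 * t₁ * t ≤ d₀ / 2 * 1 * t := by gcongr; exact ht.1
        _ = d₀ / 2 * t := by ring
        _ ≤ smoothSign t := by linarith
    · have h1 := hmono ⟨le_rfl, ht₁pos.le⟩ ⟨ht₁pos.le, le_rfl⟩ ht₁pos.le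
      simp only [mul_zero, sub_zero, smoothSign_zero] at h1
      have h2 : smoothSign t₁ ≤ smoothSign t := monotone_smoothSign h.le
      calc d₀ / 2 * t₁ * t ≤ d₀ / 2 * t₁ * 1 := by gcongr; exact ht.2
        _ = d₀ / 2 * t₁ := by ring
        _ ≤ smoothSign t₁ := by linarith
        _ ≤ smoothSign t := h2

/-! ### §2 The bump `b(x) = expNegInvGlue (1 - x²)` (`LegendrianStabilisationModel.lean`): second derivative and roots of `b' = θ` -/

/-- `b(0) = e⁻¹`. [folklore] -/
theorem bump_zero : bump 0 = Real.exp (-1) := by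
  simp [bump, expNegInvGlue]

/-- On `(-1, 1)` the derivative of the bump reads `b'(x) = -2x ((1 - x²)²)⁻¹ b(x)`. [folklore] -/
theorem dbump_eq {x : ℝ} (hx : |x| < 1) : dbump x = -2 * x * ((1 - x ^ 2) ^ 2)⁻¹ * bump x := by
  have hlt := abs_lt.1 hx
  have h1 : 0 < 1 - x ^ 2 := by nlinarith
  unfold dbump dglue bump expNegInvGlue
  rw [if_pos h1, if_neg (not_le.2 h1)]
  field_simp

/-- `b' ≤ 0` on `[0, ∞)`. [folklore] -/
theorem dbump_nonpos {x : ℝ} (hx : 0 ≤ x) : dbump x ≤ 0 := by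
  rcases hx.eq_or_lt with h | h
  · rw [← h, dbump_zero]
  rcases lt_or_ge x 1 with h1 | h1
  · exact (dbump_neg_of_pos h h1).le
  · rw [dbump_eq_zero (by rw [abs_of_pos h]; exact h1)]

/-- **The second derivative of the bump** on `(-1, 1)`:
`b''(x) = (6x⁴ - 2)((1 - x²)⁴)⁻¹ b(x)` (`b' = w b` with `w = -2x/(1-x²)²`, and
`w' + w² = (6x⁴ - 2)/(1 - x²)⁴`). [folklore] -/
theorem hasDerivAt_dbump {x : ℝ} (hx : |x| < 1) :
    HasDerivAt dbump ((6 * x ^ 4 - 2) * ((1 - x ^ 2) ^ 4)⁻¹ * bump x) x := by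
  have hlt := abs_lt.1 hx
  have hx1 : 1 - x ^ 2 ≠ 0 := by nlinarith
  -- derivative of w x = -2 x ((1 - x²)²)⁻¹
  have hq : HasDerivAt (fun x : ℝ => (1 - x ^ 2) ^ 2) (2 * (1 - x ^ 2) * -(2 * x)) x := by
    have h1 : HasDerivAt (fun x : ℝ => 1 - x ^ 2) (-(2 * x)) x := by
      simpa using (hasDerivAt_pow 2 x).const_sub 1
    have h2 := h1.mul h1
    have h3 : HasDerivAt (fun x : ℝ => (1 - x ^ 2) ^ 2)
        (-(2 * x) * (1 - x ^ 2) + (1 - x ^ 2) * -(2 * x)) x :=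
      h2.congr_of_eventuallyEq (Eventually.of_forall fun y => by simp [pow_two])
    convert h3 using 1
    ring
  have hqi : HasDerivAt (fun x : ℝ => ((1 - x ^ 2) ^ 2)⁻¹)
      (-(2 * (1 - x ^ 2) * -(2 * x)) / ((1 - x ^ 2) ^ 2) ^ 2) x :=
    hq.inv (pow_ne_zero 2 hx1)
  have hw : HasDerivAt (fun x : ℝ => -2 * x * ((1 - x ^ 2) ^ 2)⁻¹)
      (-2 * 1 * ((1 - x ^ 2) ^ 2)⁻¹ +
        -2 * x * (-(2 * (1 - x ^ 2) * -(2 * x)) / ((1 - x ^ 2) ^ 2) ^ 2)) x :=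
    (((hasDerivAt_id x).const_mul (-2)).mul hqi)
  have h := hw.mul (hasDerivAt_bump x)
  -- near `x` the formula `-2 y ((1 - y²)²)⁻¹ b(y)` IS `dbump y`
  have hev : dbump =ᶠ[𝓝 x] fun y => -2 * y * ((1 - y ^ 2) ^ 2)⁻¹ * bump y := by
    have hm : {y : ℝ | |y| < 1} ∈ 𝓝 x := (isOpen_lt continuous_abs continuous_const).mem_nhds hx
    exact eventuallyEq_of_mem hm fun y hy => dbump_eq hy
  refine (h.congr_of_eventuallyEq hev).congr_deriv ?_
  rw [dbump_eq hx]
  field_simp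
  ring

/-- The inflection abscissa `x⋆ = 3^{-1/4}` of the bump's derivative: `x⋆⁴ = 1/3`. [folklore] -/
def xStar : ℝ := Real.sqrt (Real.sqrt 3)⁻¹

/-- `x⋆ > 0`. [folklore] -/
theorem xStar_pos : 0 < xStar := by
  unfold xStar
  exact Real.sqrt_pos.2 (inv_pos.2 (Real.sqrt_pos.2 (by norm_num)))

/-- `x⋆² = (√3)⁻¹`. [folklore] -/
theorem xStar_sq : xStar ^ 2 = (Real.sqrt 3)⁻¹ := by
  unfold xStar
  rw [Real.sq_sqrt (inv_nonneg.2 (Real.sqrt_nonneg 3))]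

/-- `x⋆⁴ = 1/3`. [folklore] -/
theorem xStar_pow_four : xStar ^ 4 = 1 / 3 := by
  rw [show xStar ^ 4 = (xStar ^ 2) ^ 2 by ring, xStar_sq, inv_pow,
    Real.sq_sqrt (by norm_num : (0 : ℝ) ≤ 3)]
  norm_num

/-- `1/2 < x⋆`. [folklore] -/
theorem half_lt_xStar : 1 / 2 < xStar := by
  have h3 : Real.sqrt 3 < 2 := by
    rw [show (2 : ℝ) = Real.sqrt 4 by rw [show (4 : ℝ) = 2 ^ 2 by norm_num, Real.sqrt_sq (by norm_num)]]
    exact Real.sqrt_lt_sqrt (by norm_num) (by norm_num)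
  have hsq : (1 / 2 : ℝ) ^ 2 < xStar ^ 2 := by
    rw [xStar_sq]
    have : (1 / 2 : ℝ) < (Real.sqrt 3)⁻¹ := by
      rw [lt_inv_comm₀ (by norm_num) (Real.sqrt_pos.2 (by norm_num))]
      norm_num; exact h3
    calc (1 / 2 : ℝ) ^ 2 = 1 / 4 := by norm_num
      _ < 1 / 2 := by norm_num
      _ < (Real.sqrt 3)⁻¹ := this
  exact lt_of_pow_lt_pow_left₀ 2 xStar_pos.le hsq

/-- `x⋆ < 1`. [folklore] -/
theorem xStar_lt_one : xStar < 1 := by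
  have h3 : 1 < Real.sqrt 3 := by
    rw [show (1 : ℝ) = Real.sqrt 1 by simp]
    exact Real.sqrt_lt_sqrt (by norm_num) (by norm_num)
  have hsq : xStar ^ 2 < 1 ^ 2 := by
    rw [xStar_sq, one_pow]
    exact inv_lt_one_of_one_lt₀ h3
  exact lt_of_pow_lt_pow_left₀ 2 zero_le_one hsq

/-- Sign of `6x⁴ - 2`: positive iff `x⋆ < |x|`. [folklore] -/
theorem six_pow_four_sub_two_pos {x : ℝ} (hx : xStar < |x|) : 0 < 6 * x ^ 4 - 2 := by
  have h : xStar ^ 4 < |x| ^ 4 := pow_lt_pow_left₀ hx xStar_pos.le (by norm_num)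
  rw [xStar_pow_four, show |x| ^ 4 = x ^ 4 by
    rw [show (4 : ℕ) = 2 * 2 by norm_num, pow_mul, sq_abs, ← pow_mul]] at h
  linarith

/-- Sign of `6x⁴ - 2`: negative iff `|x| < x⋆`. [folklore] -/
theorem six_pow_four_sub_two_neg {x : ℝ} (hx : |x| < xStar) : 6 * x ^ 4 - 2 < 0 := by
  have h : |x| ^ 4 < xStar ^ 4 := pow_lt_pow_left₀ hx (abs_nonneg x) (by norm_num)
  rw [xStar_pow_four, show |x| ^ 4 = x ^ 4 by
    rw [show (4 : ℕ) = 2 * 2 by norm_num, pow_mul, sq_abs, ← pow_mul]] at h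
  linarith

/-- `b'' > 0` where `x⋆ < |x| < 1`. [folklore] -/
theorem deriv_dbump_pos {x : ℝ} (hx : xStar < |x|) (hx1 : |x| < 1) : 0 < deriv dbump x := by
  rw [(hasDerivAt_dbump hx1).deriv]
  have hlt := abs_lt.1 hx1
  have h1 : 0 < 1 - x ^ 2 := by nlinarith
  have : 0 < ((1 - x ^ 2) ^ 4)⁻¹ := by positivity
  exact mul_pos (mul_pos (six_pow_four_sub_two_pos hx) this) (bump_pos hx1)

/-- `b'' < 0` where `|x| < x⋆`. [folklore] -/
theorem deriv_dbump_neg {x : ℝ} (hx : |x| < xStar) : deriv dbump x < 0 := by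
  have hx1 : |x| < 1 := hx.trans xStar_lt_one
  rw [(hasDerivAt_dbump hx1).deriv]
  have hlt := abs_lt.1 hx1
  have h1 : 0 < 1 - x ^ 2 := by nlinarith
  have : 0 < ((1 - x ^ 2) ^ 4)⁻¹ := by positivity
  exact mul_neg_of_neg_of_pos (mul_neg_of_neg_of_pos (six_pow_four_sub_two_neg hx) this)
    (bump_pos hx1)

/-- `b'` increases strictly on `[-1, -x⋆]`. [folklore] -/
theorem strictMonoOn_dbump : StrictMonoOn dbump (Icc (-1) (-xStar)) := by
  refine strictMonoOn_of_deriv_pos (convex_Icc _ _) continuous_dbump.continuousOn ?_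
  intro x hx
  rw [interior_Icc] at hx
  exact deriv_dbump_pos (by rw [abs_of_neg (by linarith [xStar_pos, hx.2])]; linarith [hx.2])
    (by rw [abs_of_neg (by linarith [xStar_pos, hx.2])]; linarith [hx.1])

/-- `b'` decreases strictly on `[-x⋆, x⋆]`. [folklore] -/
theorem strictAntiOn_dbump : StrictAntiOn dbump (Icc (-xStar) xStar) := by
  refine strictAntiOn_of_deriv_neg (convex_Icc _ _) continuous_dbump.continuousOn ?_
  intro x hx
  rw [interior_Icc] at hx
  exact deriv_dbump_neg (abs_lt.2 ⟨hx.1, hx.2⟩)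

/-- `b'(-1/2) < b'(-x⋆)`. [folklore] -/
theorem dbump_neg_half_lt : dbump (-1 / 2) < dbump (-xStar) :=
  strictAntiOn_dbump ⟨le_rfl, by linarith [xStar_pos]⟩
    ⟨by linarith [half_lt_xStar], by linarith [xStar_pos]⟩ (by linarith [half_lt_xStar])

/-- `0 < b'(-1/2)`. [folklore] -/
theorem dbump_neg_half_pos : 0 < dbump (-1 / 2) := dbump_pos_of_neg (by norm_num) (by norm_num)

/-- **Two transversal roots.**  For `0 < θ < b'(-1/2)` the equation `b'(x) = θ` has exactly two
solutions: `x₁ ∈ (-1, -x⋆)`, where `b'' > 0`, and `x₂ ∈ (-1/2, 0)`, where `b'' < 0`. [folklore] -/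
theorem exists_two_roots_dbump {θ : ℝ} (hθ : 0 < θ) (hθ' : θ < dbump (-1 / 2)) :
    ∃ x₁ x₂ : ℝ, x₁ ∈ Ioo (-1) (-xStar) ∧ x₂ ∈ Ioo (-1 / 2) 0 ∧ dbump x₁ = θ ∧ dbump x₂ = θ ∧
      0 < deriv dbump x₁ ∧ deriv dbump x₂ < 0 ∧ ∀ x, dbump x = θ → x = x₁ ∨ x = x₂ := by
  have hxs := half_lt_xStar
  have hx1 := xStar_lt_one
  -- root on [-1, -x⋆] by the intermediate value theorem
  have hivt1 : θ ∈ Ioo (dbump (-1)) (dbump (-xStar)) := by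
    rw [dbump_eq_zero (by norm_num)]
    exact ⟨hθ, hθ'.trans dbump_neg_half_lt⟩
  obtain ⟨x₁, hx₁mem, hx₁⟩ := intermediate_value_Ioo (by linarith)
    continuous_dbump.continuousOn hivt1
  -- root on [-1/2, 0]
  have hivt2 : θ ∈ Ioo (dbump 0) (dbump (-1 / 2)) := by rw [dbump_zero]; exact ⟨hθ, hθ'⟩
  obtain ⟨x₂, hx₂mem, hx₂⟩ := intermediate_value_Ioo' (by norm_num)
    continuous_dbump.continuousOn hivt2
  refine ⟨x₁, x₂, hx₁mem, hx₂mem, hx₁, hx₂, ?_, ?_, fun x hx => ?_⟩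
  · exact deriv_dbump_pos (by rw [abs_of_neg (by linarith [hx₁mem.2, xStar_pos])]; linarith [hx₁mem.2])
      (by rw [abs_of_neg (by linarith [hx₁mem.2, xStar_pos])]; linarith [hx₁mem.1])
  · exact deriv_dbump_neg (by rw [abs_of_neg hx₂mem.2]; linarith [hx₂mem.1])
  · -- uniqueness: a root lies in (-1, 0)
    have hxpos : 0 < dbump x := hx ▸ hθ
    have hxlt0 : x < 0 := by
      by_contra h
      exact absurd (dbump_nonpos (not_lt.1 h)) (not_le.2 hxpos)
    have hxgt : -1 < x := by
      by_contra h
      rw [dbump_eq_zero (by rw [abs_of_neg hxlt0]; linarith)] at hxpos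
      exact lt_irrefl _ hxpos
    rcases le_or_gt x (-xStar) with h | h
    · left
      exact strictMonoOn_dbump.injOn ⟨hxgt.le, h⟩ ⟨hx₁mem.1.le, hx₁mem.2.le⟩ (hx.trans hx₁.symm)
    · right
      exact strictAntiOn_dbump.injOn ⟨h.le, by linarith [xStar_pos]⟩
        ⟨by linarith [hx₂mem.1], by linarith [hx₂mem.2, xStar_pos]⟩ (hx.trans hx₂.symm)

/-! ### §3 The convex barrier `p(t) = 6 ∫₀ᵗ ∫₀ˢ smoothTransition` -/

/-- The ramp primitive `P(t) = ∫₀ᵗ smoothTransition`. [folklore] -/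
def rampPrim (t : ℝ) : ℝ := ∫ r in (0 : ℝ)..t, smoothTransition r

/-- `P' = smoothTransition`. [folklore] -/
theorem hasDerivAt_rampPrim (t : ℝ) : HasDerivAt rampPrim (smoothTransition t) t :=
  intervalIntegral.integral_hasDerivAt_right
    (smoothTransition.continuous.intervalIntegrable 0 t)
    (smoothTransition.continuous.stronglyMeasurableAtFilter volume (𝓝 t))
    smoothTransition.continuousAt

/-- `deriv P = smoothTransition`. [folklore] -/
theorem deriv_rampPrim : deriv rampPrim = smoothTransition :=
  funext fun t => (hasDerivAt_rampPrim t).deriv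

/-- `P` is smooth. [folklore] -/
theorem contDiff_rampPrim : ContDiff ℝ ∞ rampPrim :=
  contDiff_infty_iff_deriv.2 ⟨fun t => (hasDerivAt_rampPrim t).differentiableAt, by
    rw [deriv_rampPrim]; exact smoothTransition.contDiff⟩

/-- `P` is continuous. [folklore] -/
theorem continuous_rampPrim : Continuous rampPrim := contDiff_rampPrim.continuous

/-- `P(0) = 0`. [folklore] -/
theorem rampPrim_zero : rampPrim 0 = 0 := by simp [rampPrim]

/-- `P = 0` on `(-∞, 0]` (the integrand vanishes there). [folklore] -/
theorem rampPrim_of_nonpos {t : ℝ} (ht : t ≤ 0) : rampPrim t = 0 := by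
  unfold rampPrim
  rw [intervalIntegral.integral_symm, neg_eq_zero]
  apply intervalIntegral.integral_zero_ae
  refine Eventually.of_forall fun r hr => ?_
  rw [uIoc_of_le ht, mem_Ioc] at hr
  exact smoothTransition.zero_of_nonpos hr.2

/-- `P` is non-decreasing. [folklore] -/
theorem monotone_rampPrim : Monotone rampPrim :=
  monotone_of_deriv_nonneg (fun t => (hasDerivAt_rampPrim t).differentiableAt) fun t => by
    rw [deriv_rampPrim]; exact smoothTransition.nonneg t

/-- `P` is strictly increasing on `[0, ∞)`. [folklore] -/
theorem strictMonoOn_rampPrim : StrictMonoOn rampPrim (Ici 0) := by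
  refine strictMonoOn_of_deriv_pos (convex_Ici 0) continuous_rampPrim.continuousOn ?_
  intro t ht
  rw [interior_Ici] at ht
  rw [deriv_rampPrim]
  exact smoothTransition.pos_of_pos ht

/-- `P ≥ 0`. [folklore] -/
theorem rampPrim_nonneg (t : ℝ) : 0 ≤ rampPrim t := by
  rcases le_or_gt t 0 with h | h
  · rw [rampPrim_of_nonpos h]
  · rw [← rampPrim_zero]; exact monotone_rampPrim h.le

/-- `P > 0` on `(0, ∞)`. [folklore] -/
theorem rampPrim_pos {t : ℝ} (ht : 0 < t) : 0 < rampPrim t := by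
  rw [← rampPrim_zero]; exact strictMonoOn_rampPrim (mem_Ici.2 le_rfl) (mem_Ici.2 ht.le) ht

/-- `P(t) ≤ t` for `t ≥ 0`. [folklore] -/
theorem rampPrim_le {t : ℝ} (ht : 0 ≤ t) : rampPrim t ≤ t := by
  unfold rampPrim
  have h := intervalIntegral.integral_mono_on (μ := volume) ht
    (smoothTransition.continuous.intervalIntegrable 0 t)
    ((continuous_const (y := (1 : ℝ))).intervalIntegrable 0 t)
    (fun r _ => smoothTransition.le_one r)
  simpa using h

/-- `t - 1 ≤ P(t)` for `t ≥ 1` (the integrand is `1` on `[1, t]`). [folklore] -/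
theorem sub_one_le_rampPrim {t : ℝ} (ht : 1 ≤ t) : t - 1 ≤ rampPrim t := by
  unfold rampPrim
  rw [← intervalIntegral.integral_add_adjacent_intervals
    (smoothTransition.continuous.intervalIntegrable 0 1)
    (smoothTransition.continuous.intervalIntegrable 1 t)]
  have h0 : 0 ≤ ∫ r in (0 : ℝ)..1, smoothTransition r :=
    intervalIntegral.integral_nonneg zero_le_one fun r _ => smoothTransition.nonneg r
  have h1 : ∫ r in (1 : ℝ)..t, smoothTransition r = ∫ _ in (1 : ℝ)..t, (1 : ℝ) := by
    apply intervalIntegral.integral_congr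
    intro r hr
    rw [uIcc_of_le ht, mem_Icc] at hr
    exact smoothTransition.one_of_one_le hr.1
  rw [h1, intervalIntegral.integral_const, smul_eq_mul, mul_one]
  linarith

/-- The **barrier** `p(t) = 6 ∫₀ᵗ P`. [folklore] -/
def barrier (t : ℝ) : ℝ := 6 * ∫ s in (0 : ℝ)..t, rampPrim s

/-- `p' = 6 P`. [folklore] -/
theorem hasDerivAt_barrier (t : ℝ) : HasDerivAt barrier (6 * rampPrim t) t :=
  (intervalIntegral.integral_hasDerivAt_right (continuous_rampPrim.intervalIntegrable 0 t)
    (continuous_rampPrim.stronglyMeasurableAtFilter volume (𝓝 t))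
    continuous_rampPrim.continuousAt).const_mul 6

/-- `deriv p = 6 P`. [folklore] -/
theorem deriv_barrier : deriv barrier = fun t => 6 * rampPrim t :=
  funext fun t => (hasDerivAt_barrier t).deriv

/-- `p` is smooth. [folklore] -/
theorem contDiff_barrier : ContDiff ℝ ∞ barrier :=
  contDiff_infty_iff_deriv.2 ⟨fun t => (hasDerivAt_barrier t).differentiableAt, by
    rw [deriv_barrier]; exact contDiff_const.mul contDiff_rampPrim⟩

/-- `p = 0` on `(-∞, 0]`. [folklore] -/
theorem barrier_of_nonpos {t : ℝ} (ht : t ≤ 0) : barrier t = 0 := by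
  unfold barrier
  rw [intervalIntegral.integral_symm]
  have : ∫ s in t..(0 : ℝ), rampPrim s = 0 := by
    apply intervalIntegral.integral_zero_ae
    refine Eventually.of_forall fun r hr => ?_
    rw [uIoc_of_le ht, mem_Ioc] at hr
    exact rampPrim_of_nonpos hr.2
  rw [this]; simp

/-- `p ≥ 0`. [folklore] -/
theorem barrier_nonneg (t : ℝ) : 0 ≤ barrier t := by
  rcases le_or_gt t 0 with h | h
  · rw [barrier_of_nonpos h]
  · unfold barrier
    exact mul_nonneg (by norm_num) (intervalIntegral.integral_nonneg h.le fun r _ => rampPrim_nonneg r)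

/-- `p' ≥ 0`. [folklore] -/
theorem deriv_barrier_nonneg (t : ℝ) : 0 ≤ deriv barrier t := by
  rw [deriv_barrier]; exact mul_nonneg (by norm_num) (rampPrim_nonneg t)

/-- `p' = 0` on `(-∞, 0]`. [folklore] -/
theorem deriv_barrier_of_nonpos {t : ℝ} (ht : t ≤ 0) : deriv barrier t = 0 := by
  rw [deriv_barrier]; simp [rampPrim_of_nonpos ht]

/-- `p'` is strictly increasing on `[0, ∞)`. [folklore] -/
theorem strictMonoOn_deriv_barrier : StrictMonoOn (deriv barrier) (Ici 0) := by
  rw [deriv_barrier]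
  exact fun a ha b hb hab => by
    have := strictMonoOn_rampPrim ha hb hab
    dsimp only; linarith

/-- `p'' = 6·smoothTransition`. [folklore] -/
theorem hasDerivAt_deriv_barrier (t : ℝ) : HasDerivAt (deriv barrier) (6 * smoothTransition t) t := by
  rw [deriv_barrier]; exact (hasDerivAt_rampPrim t).const_mul 6

/-- `p'' > 0` on `(0, ∞)`. [folklore] -/
theorem deriv_deriv_barrier_pos {t : ℝ} (ht : 0 < t) : 0 < deriv (deriv barrier) t := by
  rw [(hasDerivAt_deriv_barrier t).deriv]
  exact mul_pos (by norm_num) (smoothTransition.pos_of_pos ht)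

/-- `6 (t - 1) ≤ p'(t)` for `t ≥ 1`. [folklore] -/
theorem le_deriv_barrier {t : ℝ} (ht : 1 ≤ t) : 6 * (t - 1) ≤ deriv barrier t := by
  rw [deriv_barrier]; dsimp only; linarith [sub_one_le_rampPrim ht]

/-- **Quadratic growth**: `3 (t - 1)² ≤ p(t)` for `t ≥ 1`. [folklore] -/
theorem barrier_ge {t : ℝ} (ht : 1 ≤ t) : 3 * (t - 1) ^ 2 ≤ barrier t := by
  -- `p(t) - 3 (t - 1)²` is non-decreasing on `[1, ∞)` and vanishes... is `≥ 0` at `t = 1`.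
  have hmono : MonotoneOn (fun t => barrier t - 3 * (t - 1) ^ 2) (Ici 1) := by
    refine monotoneOn_of_deriv_nonneg (convex_Ici 1) ?_ ?_ ?_
    · exact (contDiff_barrier.continuous.sub (continuous_const.mul
        ((continuous_id.sub continuous_const).pow 2))).continuousOn
    · intro x _
      exact ((hasDerivAt_barrier x).sub (((hasDerivAt_id x).sub_const 1).pow 2 |>.const_mul 3))
        |>.differentiableAt.differentiableWithinAt
    · intro x hx
      rw [interior_Ici] at hx
      have hd : HasDerivAt (fun t => barrier t - 3 * (t - 1) ^ 2)
          (6 * rampPrim x - 3 * (↑2 * (x - 1) ^ (2 - 1) * 1)) x :=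
        (hasDerivAt_barrier x).sub (((hasDerivAt_id x).sub_const 1).pow 2 |>.const_mul 3)
      rw [hd.deriv]
      norm_num
      linarith [sub_one_le_rampPrim hx.le]
  have h := hmono (mem_Ici.2 le_rfl) (mem_Ici.2 ht) ht
  simp only [sub_self, zero_pow two_ne_zero, mul_zero, sub_zero] at h
  linarith [barrier_nonneg 1]

/-- **The unique root of `p' = τ`.**  For `τ > 0` there is exactly one `t₀` with `p'(t₀) = τ`; it
is positive and `p''(t₀) > 0`. [folklore] -/
theorem exists_unique_root_deriv_barrier {τ : ℝ} (hτ : 0 < τ) :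
    ∃ t₀ : ℝ, 0 < t₀ ∧ deriv barrier t₀ = τ ∧ 0 < deriv (deriv barrier) t₀ ∧
      ∀ t, deriv barrier t = τ → t = t₀ := by
  -- intermediate value theorem on [0, τ/6 + 1]
  set T : ℝ := τ / 6 + 2 with hT
  have hT1 : 1 ≤ T := by rw [hT]; linarith
  have hcont : Continuous (deriv barrier) := by
    rw [deriv_barrier]; exact continuous_const.mul continuous_rampPrim
  have hivt : τ ∈ Ioo (deriv barrier 0) (deriv barrier T) := by
    rw [deriv_barrier_of_nonpos le_rfl]
    refine ⟨hτ, ?_⟩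
    have := le_deriv_barrier hT1
    rw [hT] at this ⊢
    linarith
  obtain ⟨t₀, ht₀mem, ht₀⟩ := intermediate_value_Ioo (by linarith) hcont.continuousOn hivt
  refine ⟨t₀, ht₀mem.1, ht₀, deriv_deriv_barrier_pos ht₀mem.1, fun t ht => ?_⟩
  have htpos : 0 < t := by
    by_contra h
    rw [deriv_barrier_of_nonpos (not_lt.1 h)] at ht
    exact absurd ht hτ.ne
  exact strictMonoOn_deriv_barrier.injOn (mem_Ici.2 htpos.le) (mem_Ici.2 ht₀mem.1.le)
    (ht.trans ht₀.symm)

end Ladder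

end Literature.Topology.FourManifolds
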